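import Mathlib
import Summits.Ventures.HodgeRepro.BallGenLemmaW

/-!
# The rational points: the unitary group of `(K^{p+1}, J)` over a CM field inside `U(p,1)`

Blind re-derivation cell `pub-hodge-repro`, seat `typer-2` (gen 3).  ROUTE.md v2.1 Appendix A4 (Lemma W) applies the
pointwise wedge lemma to `Δ =` the image of `G(ℚ)`, `G = Res_{F⁺/ℚ} U(V)`, in `U(p,1)`, which is dense by real
approximation (Milne, *Algebraic Groups*, Thm. 25.70).  Here the objects are made precise on Mathlib for the split
Hermitian form `J = diag(1, …, 1, −1)` over a CM field `K` (Mathlib's `IsCMField K`, with `star = complexConj K`):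
`UK K p` = the `K`-points `{g ∈ GL_{p+1}(K) : ḡᵀ J g = J}` (= `G(ℚ)` for `V = K^{p+1}` with the form `J`), the map
`embU φ₀ : UK K p →* U p` induced by an embedding `φ₀ : K → ℂ` (it lands in `U(p,1)` because `φ₀ ∘ star = star ∘ φ₀`,
`IsCMField.complexEmbedding_complexConj`), and `ratPoints φ₀` = its image — the concrete `Δ` of Lemma W.  Density of
`ratPoints φ₀` in `U(p,1)` is NOT proved here (it is the printed real-approximation theorem); `lemmaW_rational` states
Lemma W with that density as its one explicit hypothesis.  TODO(general form): an arbitrary Hermitian form `H` of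
signature `(p,1)` at `φ₀` (then `H_ℂ = Pᴴ J P` by Sylvester and the group is conjugate to `U(p,1)`).
-/

set_option autoImplicit false

noncomputable section

namespace HodgeRepro.BallGen

open Matrix NumberField

section UK

variable (K : Type*) [Field K] [NumberField K] [IsCMField K] (p : ℕ)

/-- `J = diag(1, …, 1, −1)` with entries in `K`. -/
def JK : Matrix (Idx p) (Idx p) K := Matrix.diagonal (Sum.elim (fun _ => 1) (fun _ => -1))

omit [NumberField K] [IsCMField K] in
/-- `J * J = 1` over `K`. -/
theorem JK_mul_JK : JK K p * JK K p = 1 := by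
  rw [JK, Matrix.diagonal_mul_diagonal]
  ext i j
  rcases i with i | i <;> rcases j with j | j <;> simp [Matrix.diagonal, Matrix.one_apply]

/-- **The `K`-points of the unitary group of `(K^{p+1}, J)`**: `{g ∈ GL_{p+1}(K) : ḡᵀ J g = J}`, with `ḡ` the entrywise
CM conjugation (`star`). -/
def UK : Subgroup (GL (Idx p) K) where
  carrier := {g | (g : Matrix (Idx p) (Idx p) K)ᴴ * JK K p * (g : Matrix (Idx p) (Idx p) K) = JK K p}
  mul_mem' := by
    intro g h hg hh
    simp only [Set.mem_setOf_eq, Units.val_mul, conjTranspose_mul] at hg hh ⊢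
    calc (h : Matrix (Idx p) (Idx p) K)ᴴ * (g : Matrix (Idx p) (Idx p) K)ᴴ * JK K p *
          ((g : Matrix (Idx p) (Idx p) K) * (h : Matrix (Idx p) (Idx p) K))
        = (h : Matrix (Idx p) (Idx p) K)ᴴ * ((g : Matrix (Idx p) (Idx p) K)ᴴ * JK K p *
          (g : Matrix (Idx p) (Idx p) K)) * (h : Matrix (Idx p) (Idx p) K) := by
          simp only [Matrix.mul_assoc]
      _ = JK K p := by rw [hg, hh]
  one_mem' := by simp
  inv_mem' := by
    intro g hg
    simp only [Set.mem_setOf_eq] at hg ⊢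
    set gi : Matrix (Idx p) (Idx p) K := ((g⁻¹ : GL (Idx p) K) : Matrix (Idx p) (Idx p) K) with hgi
    have hmul : (g : Matrix (Idx p) (Idx p) K) * gi = 1 := by
      rw [hgi, ← Units.val_mul, mul_inv_cancel, Units.val_one]
    calc giᴴ * JK K p * gi = giᴴ * ((g : Matrix (Idx p) (Idx p) K)ᴴ * JK K p * (g : Matrix (Idx p) (Idx p) K)) * gi := by
          rw [hg]
      _ = ((g : Matrix (Idx p) (Idx p) K) * gi)ᴴ * JK K p * ((g : Matrix (Idx p) (Idx p) K) * gi) := by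
          simp only [conjTranspose_mul, Matrix.mul_assoc]
      _ = JK K p := by rw [hmul]; simp

end UK

section Emb

variable {K : Type*} [Field K] [NumberField K] [IsCMField K] {p : ℕ}

/-- The defining relation of a `K`-point. -/
theorem UK_rel (g : UK K p) : ((g : GL (Idx p) K) : Matrix (Idx p) (Idx p) K)ᴴ * JK K p *
    ((g : GL (Idx p) K) : Matrix (Idx p) (Idx p) K) = JK K p := g.2

/-- An embedding `φ₀ : K → ℂ` intertwines the CM conjugation and complex conjugation. -/
theorem map_star_eq (φ₀ : K →+* ℂ) (x : K) : φ₀ (star x) = star (φ₀ x) := by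
  show φ₀ (IsCMField.complexConj K x) = star (φ₀ x)
  rw [IsCMField.complexEmbedding_complexConj]
  rfl

/-- `φ₀` commutes with the conjugate transpose. -/
theorem conjTranspose_map_emb (φ₀ : K →+* ℂ) (A : Matrix (Idx p) (Idx p) K) : Aᴴ.map φ₀ = (A.map φ₀)ᴴ :=
  Matrix.conjTranspose_map φ₀ fun x => map_star_eq φ₀ x

omit [IsCMField K] in
/-- `φ₀` sends `J` over `K` to `J` over `ℂ`. -/
theorem map_JK (φ₀ : K →+* ℂ) : (JK K p).map φ₀ = J p := by
  rw [JK, J, Matrix.diagonal_map (map_zero φ₀)]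
  congr 1
  ext i
  rcases i with i | i <;> simp

/-- The map `GL_{p+1}(K) →* GL_{p+1}(ℂ)` induced by `φ₀`. -/
abbrev embGL (φ₀ : K →+* ℂ) : GL (Idx p) K →* GLp p := Units.map (φ₀.mapMatrix).toMonoidHom

omit [NumberField K] [IsCMField K] in
/-- The matrix of `embGL φ₀ g` is the entrywise image. -/
theorem coe_embGL (φ₀ : K →+* ℂ) (g : GL (Idx p) K) :
    ((embGL φ₀ g : GLp p) : Matrix (Idx p) (Idx p) ℂ) = (g : Matrix (Idx p) (Idx p) K).map φ₀ := rfl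

/-- The `K`-points land in `U(p,1)`. -/
theorem embGL_mem (φ₀ : K →+* ℂ) (g : UK K p) : embGL φ₀ (g : GL (Idx p) K) ∈ U p := by
  show ((embGL φ₀ (g : GL (Idx p) K) : GLp p) : Matrix (Idx p) (Idx p) ℂ)ᴴ * J p *
      ((embGL φ₀ (g : GL (Idx p) K) : GLp p) : Matrix (Idx p) (Idx p) ℂ) = J p
  rw [coe_embGL, ← conjTranspose_map_emb, ← map_JK φ₀, ← Matrix.map_mul, ← Matrix.map_mul, UK_rel]

/-- **The rational points in `U(p,1)`**: `embU φ₀ : UK K p →* U p`. -/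
def embU (φ₀ : K →+* ℂ) : UK K p →* U p :=
  ((embGL φ₀).comp (UK K p).subtype).codRestrict (U p) (embGL_mem φ₀)

/-- The matrix of `embU φ₀ g`. -/
@[simp] theorem mat_embU (φ₀ : K →+* ℂ) (g : UK K p) :
    mat (embU φ₀ g) = ((g : GL (Idx p) K) : Matrix (Idx p) (Idx p) K).map φ₀ := rfl

/-- **`Δ` of Lemma W**: the image of the `K`-points of `U(K^{p+1}, J)` in `U(p,1)`. -/
def ratPoints (K : Type*) [Field K] [NumberField K] [IsCMField K] (p : ℕ) (φ₀ : K →+* ℂ) : Subgroup (U p) :=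
  (embU (K := K) (p := p) φ₀).range

/-- Membership in `ratPoints`. -/
theorem mem_ratPoints (φ₀ : K →+* ℂ) (γ : U p) : γ ∈ ratPoints K p φ₀ ↔ ∃ g : UK K p, embU φ₀ g = γ :=
  Iff.rfl

/-- **Lemma W on the rational points** (ROUTE.md A4 with its one printed input as the hypothesis `hdense`, the real
approximation theorem: `ratPoints K p φ₀` is dense in `U(p,1)`): for `i < p`, covectors `v` linearly independent at
some point and a continuous `ω` non-zero somewhere, some RATIONAL `γ = embU φ₀ g` and some `z` have
`v₁(z) ∧ ⋯ ∧ v_i(z) ∧ (γ^*ω)(z) ≠ 0`. -/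
theorem lemmaW_rational {i : ℕ} (hi : i < p) (φ₀ : K →+* ℂ)
    (hdense : Dense ((ratPoints K p φ₀ : Subgroup (U p)) : Set (U p)))
    (v : Ball p → Fin i → Fin p → ℂ) {ω : Ball p → Fin p → ℂ} (hω : Continuous ω)
    (hv : ∃ z, LinearIndependent ℂ (v z)) (hω0 : ∃ w, ω w ≠ 0) :
    ∃ g : UK K p, ∃ z : Ball p, LinearIndependent ℂ (v z) ∧
      pullback (embU φ₀ g) ω z ∉ Submodule.span ℂ (Set.range (v z)) := by
  obtain ⟨γ, hγ, z, hz, hγz⟩ := lemmaW_core hi hdense v hω hv hω0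
  obtain ⟨g, rfl⟩ := (mem_ratPoints φ₀ γ).1 hγ
  exact ⟨g, z, hz, hγz⟩

end Emb

end HodgeRepro.BallGen

end
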